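import Summits.AtomisticToContinuum.BoseEinsteinCondensation.Theorems.BECInsertionCorrectorStaticResponseBoundFewBody5WeightedSquare
import Summits.AtomisticToContinuum.BoseEinsteinCondensation.Theorems.BECInsertionCorrectorStaticResponseBoundModulationEulerLagrange
import Summits.AtomisticToContinuum.BoseEinsteinCondensation.Theorems.BECInsertionCorrectorStaticResponseBoundWeightedGap
import HarnessLib

/-!
# The weighted completed square for the static response bound (few-body half, every coupling), II:
# the algebraic core and the Euler–Lagrange bound (line `stable-fraction-square-completion`, seat a1;
# item stmt-AtomisticToContinuum-12057 — this file supports, does not close, the item)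

Helper file 2/3 of the registered stub `stub_allCouplingPT`.  Dictionary (as in part I `…FewBodyPerturbative`): `Φ > 0` a
real `C¹` finite-energy MINIMISER of `E_w` (value `λ`), `F = |Φ|`, `θ = a + η` (`a = ∫θF²`), `m = ∫η²F²`,
`D = 𝓔_F(η)`, `g m ≤ D` (`g = (2π/L)² − 2λ ≥ 3λ`), `T₀ = ∫|∇F|² ≤ λ`, `S = ⟨V⟩_Φ` with `tS ≥ 0`,
`B` the force field of file 1/3, `P₂ = ∫BηF`, `P₃ = ∫Bη²F`, `Z² = ∫η²|∇F|²`, `I = t∫Vθ²F²`.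

* `allCoupling_algebraic_core` — from the weighted square (`κ = 1/4`):
  `−(4t²N/|p|²)(a²+m) + ta²S − (2t/|p|²)(2aP₂ + P₃) ≤ D/4 + I`, the Euler–Lagrange bound `Z² ≤ λm + 2√D Z`, the
  Cauchy–Schwarz bounds `|P₂| ≤ √m√(|p|²NT₀)`, `|P₃| ≤ √m√(|p|²N)Z` and `λm, mT₀ ≤ D/3`:  `D + I ≥ −14t²(N/|p|²)(a²+m)`
  (AM–GM; real arithmetic only);
* `pt5_eulerLagrange_sq_bound` — `Z² ≤ λm + 2√D·Z`: `eulerLagrange_of_isMinimiser` tested with `ζ = η²`, the product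
  rule `∇F·∇(η²F) = η²|∇F|² + 2ηF∇F·∇η`, `W ≥ 0` and Cauchy–Schwarz;
* pointwise and integral Cauchy–Schwarz tools (`pt5_gradDot_sq_le`, `pt5_abs_integral_mul_le`, …).

References: [ReedSimonIV1978] §XII.2; [Davies1989] §4.2 Thm 4.2.1 (ground-state transform).  Folklore otherwise.
-/

noncomputable section

namespace Summit.AtomisticToContinuum.BoseEinsteinCondensation.Cruxes.StaticResponseBound.FewBody5

open MeasureTheory Filter
open scoped ENNReal NNReal BigOperators Topology
open Literature.MathematicalPhysics.QuantumManyBody.BoseGas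
open Summit.AtomisticToContinuum.BoseEinsteinCondensation.Theses
open Summit.AtomisticToContinuum.BoseEinsteinCondensation.Theses.BECInsertionCorrector
open Summit.AtomisticToContinuum.BoseEinsteinCondensation.Theorems.StaticResponseBound.Negative
open Summit.AtomisticToContinuum.BoseEinsteinCondensation.Cruxes.StaticResponseBound.UvThomsonForceWave
open Summit.AtomisticToContinuum.BoseEinsteinCondensation.Cruxes.StaticResponseBound.FewBody

variable {N : ℕ} {L : ℝ}

/-! ## The algebraic core -/

/-- AM–GM in the form `2A ≤ x + y` from `A² ≤ x y`, `x, y ≥ 0`. [folklore] -/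
theorem pt5_two_mul_le_add_of_sq_le {A x y : ℝ} (hx : 0 ≤ x) (hy : 0 ≤ y) (h : A ^ 2 ≤ x * y) :
    2 * A ≤ x + y := by
  nlinarith [sq_nonneg (x - y), sq_nonneg (2 * A - (x + y)), sq_nonneg A]

/-- **The algebraic core of the all-coupling perturbation theory.**  Dictionary of the file header; `I = t∫Vθ²F²`,
`P₂ = ∫ηFB`, `P₃ = ∫η²FB`.  From the weighted square (`hI`), the Euler–Lagrange bound (`hZ2`), the two Cauchy–Schwarz
bounds and `λm, mT₀ ≤ D/3`: `D + I ≥ −14t²(N/|p|²)(a² + m)`. [folklore] -/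
theorem allCoupling_algebraic_core {D m a t Nr psq g lam T₀ S Z P₂ P₃ I : ℝ}
    (hD : 0 ≤ D) (hm : 0 ≤ m) (hgap : g * m ≤ D) (hpsq : 0 < psq) (hN : 0 < Nr)
    (hT0 : 0 ≤ T₀) (hT0lam : T₀ ≤ lam) (hlam : 3 * lam ≤ g) (hS : 0 ≤ t * S)
    (hZ2 : Z ^ 2 ≤ lam * m + 2 * Real.sqrt D * Z)
    (hP2 : |P₂| ≤ Real.sqrt m * Real.sqrt (psq * Nr * T₀))
    (hP3 : |P₃| ≤ Real.sqrt m * Real.sqrt (psq * Nr) * Z)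
    (hI : -(4 * t ^ 2 * Nr / psq) * (a ^ 2 + m) + t * a ^ 2 * S - (2 * t / psq) * (2 * a * P₂ + P₃) ≤ D / 4 + I) :
    -(14 * t ^ 2 * Nr / psq) * (a ^ 2 + m) ≤ D + I := by
  -- `λ m ≤ D/3`, `m T₀ ≤ D/3`
  have h3lm : 3 * lam * m ≤ g * m := mul_le_mul_of_nonneg_right hlam hm
  have hlamm : lam * m ≤ D / 3 := by nlinarith only [h3lm, hgap]
  have hmT : m * T₀ ≤ m * lam := mul_le_mul_of_nonneg_left hT0lam hm
  have hmT0 : m * T₀ ≤ D / 3 := by nlinarith only [hmT, hlamm]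
  have hpN : 0 ≤ psq * Nr := by positivity
  -- the square root of `D`
  obtain ⟨s, hs⟩ : ∃ s : ℝ, s = Real.sqrt D := ⟨_, rfl⟩
  have hs0 : 0 ≤ s := by rw [hs]; exact Real.sqrt_nonneg D
  have hs2 : s ^ 2 = D := by rw [hs]; exact Real.sq_sqrt hD
  rw [← hs] at hZ2
  -- Term 2: `(4|t||a|/psq)|P₂| ≤ D/4 + (16/3) t² a² Nr/psq`
  have hP2sq : |P₂| ^ 2 ≤ psq * Nr * (D / 3) := by
    have h0 : 0 ≤ Real.sqrt m * Real.sqrt (psq * Nr * T₀) := by positivity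
    have h1 : |P₂| ^ 2 ≤ (Real.sqrt m * Real.sqrt (psq * Nr * T₀)) ^ 2 :=
      pow_le_pow_left₀ (abs_nonneg _) hP2 2
    rw [mul_pow, Real.sq_sqrt hm, Real.sq_sqrt (by positivity)] at h1
    have h2 : m * (psq * Nr * T₀) = (psq * Nr) * (m * T₀) := by ring
    rw [h2] at h1
    exact h1.trans (mul_le_mul_of_nonneg_left hmT0 hpN)
  have hT2 : 4 * |t| * |a| / psq * |P₂| ≤ D / 4 + 16 / 3 * t ^ 2 * a ^ 2 * Nr / psq := by
    have hA2 : (2 * |t| * |a| * |P₂|) ^ 2 ≤ (D * psq / 4) * (16 / 3 * t ^ 2 * a ^ 2 * Nr) := by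
      have e1 : (2 * |t| * |a| * |P₂|) ^ 2 = 4 * (|t| ^ 2 * |a| ^ 2) * |P₂| ^ 2 := by ring
      rw [e1, sq_abs, sq_abs]
      calc 4 * (t ^ 2 * a ^ 2) * |P₂| ^ 2 ≤ 4 * (t ^ 2 * a ^ 2) * (psq * Nr * (D / 3)) :=
            mul_le_mul_of_nonneg_left hP2sq (by positivity)
        _ = (D * psq / 4) * (16 / 3 * t ^ 2 * a ^ 2 * Nr) := by ring
    have key := pt5_two_mul_le_add_of_sq_le (by positivity) (by positivity) hA2
    have e2 : 4 * |t| * |a| / psq * |P₂| = (2 * (2 * |t| * |a| * |P₂|)) / psq := by ring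
    have e3 : D / 4 + 16 / 3 * t ^ 2 * a ^ 2 * Nr / psq = (D * psq / 4 + 16 / 3 * t ^ 2 * a ^ 2 * Nr) / psq := by
      field_simp
    rw [e2, e3]
    exact div_le_div_of_nonneg_right key hpsq.le
  -- Term 3: `(2|t|/psq)|P₃| ≤ D/2 + (28/3) t² m Nr/psq`
  have hT3 : 2 * |t| / psq * |P₃| ≤ D / 2 + 28 / 3 * t ^ 2 * m * Nr / psq := by
    obtain ⟨u, hu⟩ : ∃ u : ℝ, u = |t| * (Real.sqrt m * Real.sqrt (psq * Nr)) / psq := ⟨_, rfl⟩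
    have hu0 : 0 ≤ u := by rw [hu]; positivity
    have hu2 : u ^ 2 = t ^ 2 * m * Nr / psq := by
      rw [hu, div_pow, mul_pow, mul_pow, Real.sq_sqrt hm, Real.sq_sqrt hpN, sq_abs,
        div_eq_div_iff (by positivity) hpsq.ne']
      ring
    -- `2|t||P₃|/psq ≤ 2 u Z`
    have h1 : 2 * |t| / psq * |P₃| ≤ 2 * u * Z := by
      have h := mul_le_mul_of_nonneg_left hP3 (by positivity : (0 : ℝ) ≤ 2 * |t| / psq)
      have e : 2 * |t| / psq * (Real.sqrt m * Real.sqrt (psq * Nr) * Z) = 2 * u * Z := by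
        rw [hu]; ring
      linarith
    -- `(Z - s)² ≤ (4/3) s²`
    have hZs : (Z - s) ^ 2 ≤ 4 / 3 * s ^ 2 := by nlinarith only [hZ2, hlamm, hs2]
    -- `2u(Z-s) ≤ (16/3)u² + (3/16)(Z-s)²`, `2us ≤ 4u² + s²/4`
    have h2 : 2 * u * (Z - s) ≤ 16 / 3 * u ^ 2 + 3 / 16 * (Z - s) ^ 2 := by
      nlinarith only [sq_nonneg (4 * u - 3 / 4 * (Z - s))]
    have h3 : 2 * u * s ≤ 4 * u ^ 2 + s ^ 2 / 4 := by nlinarith only [sq_nonneg (2 * u - s / 2)]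
    have h4 : 2 * u * Z ≤ 28 / 3 * u ^ 2 + s ^ 2 / 2 := by nlinarith only [h2, h3, hZs]
    rw [hu2, hs2] at h4
    have e5 : 28 / 3 * (t ^ 2 * m * Nr / psq) = 28 / 3 * t ^ 2 * m * Nr / psq := by ring
    linarith
  -- the two signed terms are bounded by their absolute values
  have hA : -(4 * |t| * |a| / psq * |P₂|) ≤ -(2 * t / psq * (2 * a * P₂)) := by
    have e : 2 * t / psq * (2 * a * P₂) = 4 * (t * a * P₂) / psq := by ring
    have habs : |4 * (t * a * P₂) / psq| = 4 * |t| * |a| / psq * |P₂| := by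
      rw [abs_div, abs_mul, abs_of_pos hpsq, abs_mul, abs_mul, abs_of_pos (by norm_num : (0 : ℝ) < 4)]
      ring
    rw [e]
    linarith [le_abs_self (4 * (t * a * P₂) / psq)]
  have hB : -(2 * |t| / psq * |P₃|) ≤ -(2 * t / psq * P₃) := by
    have habs : |2 * t / psq * P₃| = 2 * |t| / psq * |P₃| := by
      rw [abs_mul, abs_div, abs_mul, abs_of_pos hpsq, abs_of_pos (by norm_num : (0 : ℝ) < 2)]
    linarith [le_abs_self (2 * t / psq * P₃)]
  -- sum up
  have hsplit : 2 * t / psq * (2 * a * P₂ + P₃) = 2 * t / psq * (2 * a * P₂) + 2 * t / psq * P₃ := by ring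
  rw [hsplit] at hI
  have haS : 0 ≤ t * a ^ 2 * S := by
    have e : t * a ^ 2 * S = a ^ 2 * (t * S) := by ring
    rw [e]; exact mul_nonneg (sq_nonneg a) hS
  have ht2 : 0 ≤ t ^ 2 * Nr / psq := by positivity
  have hX1 : 0 ≤ t ^ 2 * Nr / psq * a ^ 2 := mul_nonneg ht2 (sq_nonneg a)
  have hX2 : 0 ≤ t ^ 2 * Nr / psq * m := mul_nonneg ht2 hm
  have hfin : -(14 * t ^ 2 * Nr / psq) * (a ^ 2 + m) ≤
      -(4 * t ^ 2 * Nr / psq) * (a ^ 2 + m) - 16 / 3 * t ^ 2 * a ^ 2 * Nr / psq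
        - 28 / 3 * t ^ 2 * m * Nr / psq := by
    have e1 : -(14 * t ^ 2 * Nr / psq) * (a ^ 2 + m) =
        -(14 * (t ^ 2 * Nr / psq * a ^ 2)) - 14 * (t ^ 2 * Nr / psq * m) := by ring
    have e2 : -(4 * t ^ 2 * Nr / psq) * (a ^ 2 + m) - 16 / 3 * t ^ 2 * a ^ 2 * Nr / psq
        - 28 / 3 * t ^ 2 * m * Nr / psq =
        -(28 / 3 * (t ^ 2 * Nr / psq * a ^ 2)) - 40 / 3 * (t ^ 2 * Nr / psq * m) := by ring
    rw [e1, e2]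
    linarith
  linarith

/-! ## Pointwise tools: Cauchy–Schwarz for `gradDot`, the force field `B` -/

/-- Pointwise Cauchy–Schwarz for the carré du champ: `(∇φ·∇ψ)² ≤ |∇φ|²|∇ψ|²`. [folklore] -/
theorem pt5_gradDot_sq_le (φ ψ : Config N → ℝ) (X : Config N) :
    gradDot φ ψ X ^ 2 ≤ gradDot φ φ X * gradDot ψ ψ X := by
  unfold gradDot
  rw [← Finset.sum_product' Finset.univ Finset.univ (fun i k => pderiv i k φ X * pderiv i k ψ X),
    ← Finset.sum_product' Finset.univ Finset.univ (fun i k => pderiv i k φ X * pderiv i k φ X),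
    ← Finset.sum_product' Finset.univ Finset.univ (fun i k => pderiv i k ψ X * pderiv i k ψ X)]
  have h := Finset.sum_mul_sq_le_sq_mul_sq (Finset.univ ×ˢ Finset.univ)
    (fun x : Fin N × Fin 3 => pderiv x.1 x.2 φ X) (fun x => pderiv x.1 x.2 ψ X)
  simpa only [sq] using h

/-- `|∇φ·∇ψ| ≤ √(|∇φ|²) √(|∇ψ|²)`. [folklore] -/
theorem pt5_abs_gradDot_le (φ ψ : Config N → ℝ) (X : Config N) :
    |gradDot φ ψ X| ≤ Real.sqrt (gradDot φ φ X) * Real.sqrt (gradDot ψ ψ X) := by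
  rw [← Real.sqrt_mul (gradDot_self_nonneg φ X), ← Real.sqrt_sq_eq_abs]
  exact Real.sqrt_le_sqrt (pt5_gradDot_sq_le φ ψ X)

/-- `|∫ φ ψ| ≤ √(∫ φ²) √(∫ ψ²)` on the cell, for continuous `φ, ψ`. [folklore] -/
theorem pt5_abs_integral_mul_le {φ ψ : Config N → ℝ} (hφ : Continuous φ) (hψ : Continuous ψ) (L : ℝ) :
    |∫ X in cellN N L, φ X * ψ X| ≤
      Real.sqrt (∫ X in cellN N L, φ X ^ 2) * Real.sqrt (∫ X in cellN N L, ψ X ^ 2) := by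
  have h := sq_integral_cellN_mul_le hφ hψ L
  have h0 : 0 ≤ ∫ X in cellN N L, φ X ^ 2 := integral_nonneg fun X => sq_nonneg _
  rw [← Real.sqrt_mul h0, ← Real.sqrt_sq_eq_abs]
  exact Real.sqrt_le_sqrt h

/-- The product rule `∇F·∇(η²F) = η²|∇F|² + 2ηF ∇F·∇η` at points of differentiability. [folklore] -/
theorem pt5_gradDot_sq_mul {F η : Config N → ℝ} {X : Config N} (hF : DifferentiableAt ℝ F X)
    (hη : DifferentiableAt ℝ η X) :
    gradDot F (fun Y => η Y ^ 2 * F Y) X = η X ^ 2 * gradDot F F X + 2 * η X * F X * gradDot F η X := by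
  have hη2 : DifferentiableAt ℝ (fun Y => η Y ^ 2) X := hη.pow 2
  unfold gradDot
  rw [Finset.mul_sum, Finset.mul_sum, ← Finset.sum_add_distrib]
  refine Finset.sum_congr rfl fun i _ => ?_
  rw [Finset.mul_sum, Finset.mul_sum, ← Finset.sum_add_distrib]
  refine Finset.sum_congr rfl fun kk _ => ?_
  rw [pderiv_fun_mul hη2 hF, pderiv_fun_sq hη]
  ring

/-! ## The stub: perturbation theory for one real component, every coupling -/

section Main

variable {w : ℝ → ℝ≥0∞} {Φ : PeriodicTrialState N L}

/-- `|Φ|` is a periodic test function for a real `C¹` periodic trial state. [folklore] -/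
theorem pt5_isPeriodicTest_norm (Φ : PeriodicTrialState N L) (hreal : ∀ X, Φ.ψ X = (‖Φ.ψ X‖ : ℂ)) :
    IsPeriodicTest L fun X => ‖Φ.ψ X‖ :=
  ⟨contDiff_norm_of_real Φ hreal, fun X i kk => by
    show ‖Φ.ψ (X + _)‖ = ‖Φ.ψ X‖
    rw [Φ.periodic X i kk]⟩

/-- **The Euler–Lagrange bound on `Z² = ∫η²|∇F|²`.**  For a positive real finite-energy minimiser `Φ` (`F = |Φ|`,
value `λ`) and a real `C¹` periodic symmetric `η`: `∫η²|∇F|² ≤ λ∫η²F² + 2√(𝓔_F(η))·√(∫η²|∇F|²)`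
(`eulerLagrange_of_isMinimiser` tested with `ζ = η²`, the product rule, `W ≥ 0` and Cauchy–Schwarz).
[cite: Davies1989, §4.2 Thm 4.2.1 (proof)] -/
theorem pt5_eulerLagrange_sq_bound (hL : 0 < L) (hw : Measurable w)
    (hreal : ∀ X, Φ.ψ X = (‖Φ.ψ X‖ : ℂ)) (hpos : ∀ X, Φ.ψ X ≠ 0) (hfin : periodicEnergy w Φ ≠ ⊤)
    (hmin : ∀ Ψ : PeriodicTrialState N L, periodicEnergy w Ψ ≠ ⊤ →
      (periodicEnergy w Φ).toReal ≤ (periodicEnergy w Ψ).toReal)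
    {η : Config N → ℝ} (hη : IsPeriodicTest L η)
    (hηsymm : ∀ (σ : Equiv.Perm (Fin N)) (X : Config N), η (X ∘ σ) = η X) :
    ∫ X in cellN N L, η X ^ 2 * gradDot (fun Y => ‖Φ.ψ Y‖) (fun Y => ‖Φ.ψ Y‖) X ≤
      (periodicEnergy w Φ).toReal * (∫ X in cellN N L, η X ^ 2 * ‖Φ.ψ X‖ ^ 2)
        + 2 * Real.sqrt (dirichletFormW L (fun X => ‖Φ.ψ X‖) η η) *
          Real.sqrt (∫ X in cellN N L, η X ^ 2 * gradDot (fun Y => ‖Φ.ψ Y‖) (fun Y => ‖Φ.ψ Y‖) X) := by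
  set F : Config N → ℝ := fun X => ‖Φ.ψ X‖ with hFdef
  have hFx : ∀ X, ‖Φ.ψ X‖ = F X := fun X => rfl
  simp_rw [hFx]
  have hF : ContDiff ℝ 1 F := contDiff_norm_of_real Φ hreal
  have hFc : Continuous F := hF.continuous
  have hF0 : ∀ X, 0 ≤ F X := fun X => norm_nonneg _
  have hηc : Continuous η := hη.continuous
  have hFd : Differentiable ℝ F := hF.differentiable one_ne_zero
  have hηd : Differentiable ℝ η := hη.differentiable
  -- Euler–Lagrange with `s = 0`, tested against `ζ = η²`
  have hmin0 : ∀ Ψ : PeriodicTrialState N L, periodicEnergy w Ψ ≠ ⊤ →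
      (periodicEnergy w Φ).toReal + 0 * cosMean L 0 Φ ≤ (periodicEnergy w Ψ).toReal + 0 * cosMean L 0 Ψ := by
    intro Ψ hΨ; simpa using hmin Ψ hΨ
  have hζ : ContDiff ℝ 1 fun X => η X ^ 2 := hη.1.pow 2
  have hζper : IsLatticePeriodic L fun X => η X ^ 2 := (pt5_isPeriodicTest_sq hη).2
  have hζsymm : ∀ (σ : Equiv.Perm (Fin N)) (X : Config N),
      (fun X => η X ^ 2) (X ∘ σ) = (fun X => η X ^ 2) X := fun σ X => by simp only [hηsymm σ X]
  have hEL := eulerLagrange_of_isMinimiser hL hw hreal hpos hfin 0 0 hmin0 hζ hζper hζsymm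
  simp only [zero_mul, add_zero] at hEL
  simp_rw [hFx] at hEL
  -- the product rule under the integral
  have hprod : ∀ X, gradDot F (fun Y => η Y ^ 2 * F Y) X =
      η X ^ 2 * gradDot F F X + 2 * (η X * F X * gradDot F η X) := fun X => by
    rw [pt5_gradDot_sq_mul (hFd X) (hηd X)]; ring
  have hgFF : Continuous (gradDot F F) := continuous_gradDot hF hF
  have hgFη : Continuous (gradDot F η) := continuous_gradDot hF hη.1
  have hgηη : Continuous (gradDot η η) := continuous_gradDot hη.1 hη.1
  have i1 : Integrable (fun X => η X ^ 2 * gradDot F F X) (volume.restrict (cellN N L)) :=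
    integrableOn_cellN ((hηc.pow 2).mul hgFF) L
  have i2 : Integrable (fun X => η X * F X * gradDot F η X) (volume.restrict (cellN N L)) :=
    integrableOn_cellN ((hηc.mul hFc).mul hgFη) L
  have hsplit : ∫ X in cellN N L, gradDot F (fun Y => η Y ^ 2 * F Y) X =
      (∫ X in cellN N L, η X ^ 2 * gradDot F F X) + 2 * ∫ X in cellN N L, η X * F X * gradDot F η X := by
    simp_rw [hprod]
    rw [integral_add i1 (i2.const_mul 2), integral_const_mul]
  -- the interaction term is nonnegative
  have hW : 0 ≤ ∫ X in cellN N L, (periodicInteraction w L X).toReal * η X ^ 2 * F X ^ 2 :=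
    setIntegral_nonneg (measurableSet_cellN N L) fun X _ => by
      have := ENNReal.toReal_nonneg (a := periodicInteraction w L X)
      positivity
  -- Cauchy–Schwarz on the cross term
  have hcross : |∫ X in cellN N L, η X * F X * gradDot F η X| ≤
      Real.sqrt (dirichletFormW L F η η) * Real.sqrt (∫ X in cellN N L, η X ^ 2 * gradDot F F X) := by
    have hφc : Continuous fun X => |η X| * Real.sqrt (gradDot F F X) :=
      (continuous_abs.comp hηc).mul (Real.continuous_sqrt.comp hgFF)
    have hψc : Continuous fun X => F X * Real.sqrt (gradDot η η X) :=
      hFc.mul (Real.continuous_sqrt.comp hgηη)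
    have hpt : ∀ X, |η X * F X * gradDot F η X| ≤
        (|η X| * Real.sqrt (gradDot F F X)) * (F X * Real.sqrt (gradDot η η X)) := by
      intro X
      rw [abs_mul, abs_mul, abs_of_nonneg (hF0 X)]
      have h := pt5_abs_gradDot_le F η X
      have h1 : 0 ≤ |η X| * F X := by positivity
      calc |η X| * F X * |gradDot F η X|
          ≤ |η X| * F X * (Real.sqrt (gradDot F F X) * Real.sqrt (gradDot η η X)) :=
            mul_le_mul_of_nonneg_left h h1
        _ = _ := by ring
    have i3 : Integrable (fun X => (|η X| * Real.sqrt (gradDot F F X)) * (F X * Real.sqrt (gradDot η η X)))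
        (volume.restrict (cellN N L)) := integrableOn_cellN (hφc.mul hψc) L
    have hstep1 : |∫ X in cellN N L, η X * F X * gradDot F η X| ≤
        ∫ X in cellN N L, (|η X| * Real.sqrt (gradDot F F X)) * (F X * Real.sqrt (gradDot η η X)) :=
      (abs_integral_le_integral_abs).trans (integral_mono i2.abs i3 hpt)
    have hstep2 := pt5_abs_integral_mul_le hφc hψc L
    have e1 : (∫ X in cellN N L, (|η X| * Real.sqrt (gradDot F F X)) ^ 2) =
        ∫ X in cellN N L, η X ^ 2 * gradDot F F X := by
      refine integral_congr_ae (ae_of_all _ fun X => ?_)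
      dsimp only
      rw [mul_pow, sq_abs, Real.sq_sqrt (gradDot_self_nonneg F X)]
    have e2 : (∫ X in cellN N L, (F X * Real.sqrt (gradDot η η X)) ^ 2) = dirichletFormW L F η η := by
      unfold dirichletFormW
      refine integral_congr_ae (ae_of_all _ fun X => ?_)
      dsimp only
      rw [mul_pow, Real.sq_sqrt (gradDot_self_nonneg η X), mul_comm]
    rw [e1, e2] at hstep2
    calc |∫ X in cellN N L, η X * F X * gradDot F η X|
        ≤ ∫ X in cellN N L, (|η X| * Real.sqrt (gradDot F F X)) * (F X * Real.sqrt (gradDot η η X)) := hstep1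
      _ ≤ |∫ X in cellN N L, (|η X| * Real.sqrt (gradDot F F X)) * (F X * Real.sqrt (gradDot η η X))| :=
          le_abs_self _
      _ ≤ Real.sqrt (∫ X in cellN N L, η X ^ 2 * gradDot F F X) * Real.sqrt (dirichletFormW L F η η) := hstep2
      _ = _ := mul_comm _ _
  -- conclude
  rw [hsplit] at hEL
  have habs := neg_abs_le (∫ X in cellN N L, η X * F X * gradDot F η X)
  nlinarith [hcross, habs, hW, Real.sqrt_nonneg (dirichletFormW L F η η),
    Real.sqrt_nonneg (∫ X in cellN N L, η X ^ 2 * gradDot F F X)]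

/-- **Registered form `pt5_eulerLagrange_sq_bound_closed`** of `pt5_eulerLagrange_sq_bound` (closed statement):
`∫η²|∇F|² ≤ λ∫η²F² + 2√(𝓔_F(η))·√(∫η²|∇F|²)` for a positive real minimiser. [cite: Davies1989, §4.2 Thm 4.2.1 (proof)] -/
theorem pt5_eulerLagrange_sq_bound_closed :
    ∀ (w : ℝ → ℝ≥0∞) (N : ℕ) (L : ℝ), 0 < L → Measurable w →
      ∀ Φ : PeriodicTrialState N L, (∀ X, Φ.ψ X = (‖Φ.ψ X‖ : ℂ)) → (∀ X, Φ.ψ X ≠ 0) →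
        periodicEnergy w Φ ≠ ⊤ →
        (∀ Ψ : PeriodicTrialState N L, periodicEnergy w Ψ ≠ ⊤ →
          (periodicEnergy w Φ).toReal ≤ (periodicEnergy w Ψ).toReal) →
        ∀ η : Config N → ℝ, IsPeriodicTest L η →
          (∀ (σ : Equiv.Perm (Fin N)) (X : Config N), η (X ∘ σ) = η X) →
          ∫ X in cellN N L, η X ^ 2 * gradDot (fun Y => ‖Φ.ψ Y‖) (fun Y => ‖Φ.ψ Y‖) X ≤
            (periodicEnergy w Φ).toReal * (∫ X in cellN N L, η X ^ 2 * ‖Φ.ψ X‖ ^ 2)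
              + 2 * Real.sqrt (dirichletFormW L (fun X => ‖Φ.ψ X‖) η η) *
                Real.sqrt (∫ X in cellN N L, η X ^ 2 * gradDot (fun Y => ‖Φ.ψ Y‖) (fun Y => ‖Φ.ψ Y‖) X) :=
  fun _w _N _L hL hw _Φ hreal hpos hfin hmin _η hη hηsymm =>
    pt5_eulerLagrange_sq_bound hL hw hreal hpos hfin hmin hη hηsymm

end Main

end Summit.AtomisticToContinuum.BoseEinsteinCondensation.Cruxes.StaticResponseBound.FewBody5

end
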